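import Summits.BirchSwinnertonDyer.Rank1Residual.O5.FlexNFIsogenousCaseSKodairaLawThreeCells
import HarnessLib

/-!
# T31 Case S `O5.FlexNormalForm.Isogenous.FlexNFIsogenousCaseSKodairaLawThree` is a THEOREM — part 2/2:
# the cells with `3 ∣ b` of the isogenous column `E′ = E/⟨P₀⟩` (`Y² = X³ − 27(bX − 4M)²`, `M = b³ − 3ᵃA₃`,
# `3 ∤ A₃`): `a = 1` ⟹ `II*`, `v₃Δ_min = 13` (minimal BY THE EXIT); `a = 2` ⟹ `II`, `v₃Δ_min = 5` (after the
# rescaling `u = 3`); and the node, as typed — Tate's algorithm in the kernel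
# (cell `b2b-bsdres`, team n1011, ROW T-FLEX-KOD FILE 2b; seat `b2b-bsdres-n1011-p18` GEN 13 under the idle
#  rule; skeleton `cells/n1011/skel/T-FLEX-KOD.md`; theorems only; part 1 = `FlexNFIsogenousCaseSKodairaLawThreeCells`)

HONEST FRAMING (cell `b2b-bsdres`, run/shared/lean/b2b/bsd-rank1-residual/, verbatim in every file): the
goal of the cell is to DELETE the COMBINATION-SHAPED residual classes of the Birch–Swinnerton-Dyer formula
for ALL analytic-rank `≤ 1` elliptic curves over `ℚ` — "full BSD formula for every rank `≤ 1` curve in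
class `C`" assembled STRICTLY from published theorems — so that the rank-`≤ 1` remainder becomes exactly
the CONSTRUCTION-SHAPED classes, which are TYPED (missing-input `Prop`s), NOT attempted. This is not
"finishing BSD". Lane CLASS-CLOSURE / O5 (O5 OPEN): research route; census output (P-K20) is EVIDENCE,
never a Literature fact; nothing is booked; no mark of `RESIDUAL-MAP.md` moves. This file: THEOREMS ONLY
(no definition, no named fact, no `@[conjecture]` node, no `sorry`; net named-fact debt `0`); nothing of
cc-typer-5's / o5-r1's files is edited; a `_holds` theorem for a conjecture node closes NO pair and moves NO mark. The O5 typer's node is proved EXACTLY as typed (its `def` imported by name).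

## What is proved

* §2 (continued) `kodairaSymbolAt_and_ord_isoQ_one_of_dvd` — `3 ∣ b`, `a = 1`, no translation: with `b = 3c`,
  `M = 3(9c³ − A₃)`: `9 ∣ a₂ = −27b²`, `81 ∣ a₄ = 216bM`, `3⁵ ∥ a₆ = −432M²` ⟹ **II*** (Steps 9–10), and the
  model is minimal because the algorithm EXITS at Step 10 (`v₃Δ = 13`, so neither `v₃Δ < 12` nor `v₃c₄ < 4`
  applies); `kodairaSymbolAt_and_ord_isoQ_two_of_dvd` — `3 ∣ b`, `a = 2` (`b = 3c`, `M = 9N`, `N = 3c³ − A₃`):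
  the given model has `v₃Δ = 17` and is NOT minimal; `(u, r, s, t) = (3, 0, 0, 0)` gives the integer model
  `[0, −27c², 0, 72cN, −48N²]`, `v₃Δ = 5`, Step-2 normalised with `3 ∥ a₆` ⟹ **II** (Step 3).
* §3 **`flexNFIsogenousCaseSKodairaLawThree_holds : FlexNFIsogenousCaseSKodairaLawThree`** — o5-r1 GEN 14's
  THEOREM-CANDIDATE (cc-typer-5 A-O5-29, `O5/FlexNormalFormIsogenous.lean` l.240), binders verbatim: for
  `a ∈ {1,2}`, `3 ∤ A₃`, `isoQ b A₃ a` has at `3` the Kodaira symbol and conductor exponent of `isoS a b`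
  (`II* / IV* / II / II*`, `f₃ = 5 / 4 / 5 / 3`); `f₃` by Ogg's formula = the tree's definition of
  `conductorExponent` = `oggF`.  The node keeps its `@[conjecture]` tag in the typer's file (the lane's restamp
  to make); census P-K20 (20 396 Case-S rows, 0 exceptions) stays EVIDENCE.

Not claimed: the `c` / `a(φ̂)` fields of `isoS`; T31 Case N; T30.4; anything about Selmer groups or BSD.

References: J. H. Silverman, *Advanced Topics in the Arithmetic of Elliptic Curves*, GTM 151 (1994), IV.9.4
Steps 1–11, Table 4.1, IV.11.1 [SilvermanATAEC1994]; J. H. Silverman, *The Arithmetic of Elliptic Curves*,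
GTM 106 (2009), VII.1 Prop. 1.3, Remark 1.1 [SilvermanAEC2009]; o5-r1 GEN 14 `T31-ISOGENOUS-COLUMN.md` §1,
census P-K20 (EVIDENCE).
-/

open scoped NumberField

open IsDedekindDomain Rat.HeightOneSpectrum WeierstrassCurve NumberField
  Literature.NumberTheory.EllipticCurves Literature.NumberTheory.GaloisRepresentations
  Literature.NumberTheory.DiophantineGeometry Literature.NumberTheory.DiophantineGeometry.TateAlgorithm
  Summit.BirchSwinnertonDyer.BirchSwinnertonDyer.Rank2Observatory.Tate
  Summit.BirchSwinnertonDyer.Rank1Residual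

namespace Summit.BirchSwinnertonDyer.Rank1Residual.O5.FlexNormalForm.Isogenous

/-! ## §2 (continued) The two cells with `3 ∣ b` -/

/-- **`3 ∣ b`, `a = 1`: type `II*` at `3`, `ord₃ Δ_min = 13`** — no translation: with `b = 3c`,
`M = 3(9c³ − A₃)`: `9 ∣ a₂ = −27b²`, `81 ∣ a₄ = 216bM`, `3⁵ ∥ a₆ = −432M²`; the model is minimal
because the algorithm EXITS at Step 10 (not by `v₃Δ < 12`, which fails here).
[cite: SilvermanATAEC1994, IV.9.4 Steps 9–11] -/
theorem kodairaSymbolAt_and_ord_isoQ_one_of_dvd (b A₃ : ℤ) (hA : ¬ (3 : ℤ) ∣ A₃) (hb : (3 : ℤ) ∣ b) :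
    (isoQ b A₃ 1).kodairaSymbolAt (Additive.placeOf 3) = .IIstar ∧
      (isoQ b A₃ 1).ordMinimalDiscriminant (Additive.placeOf 3) = 13 := by
  rw [isoQ_eq_baseChange]
  obtain ⟨c, rfl⟩ := hb
  set N := 9 * c ^ 3 - A₃ with hN
  have hM : (3 * c) ^ 3 - 3 ^ 1 * A₃ = 3 * N := by rw [hN]; ring
  rw [hM]
  have hNu : ¬ (3 : ℤ) ∣ N := by
    intro h
    have : (3 : ℤ) ∣ A₃ := by
      have h9 : (3 : ℤ) ∣ 9 * c ^ 3 := Dvd.intro (3 * c ^ 3) (by ring)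
      simpa [hN] using dvd_sub h9 h
    exact hA this
  set W₀ : WeierstrassCurve ℤ := isoModel (3 * c) (3 * N) with hW₀
  have e1 : W₀.a₁ = 0 := rfl
  have e2 : W₀.a₂ = 3 ^ 2 * (-(27 * c ^ 2)) := by simp [hW₀, isoModel]; ring
  have e3 : W₀.a₃ = 0 := rfl
  have e4 : W₀.a₄ = 3 ^ 4 * (24 * c * N) := by simp [hW₀, isoModel]; ring
  have e6 : W₀.a₆ = 3 ^ 5 * (-(16 * N ^ 2)) := by simp [hW₀, isoModel]; ring
  have eΔ : W₀.Δ = 3 ^ 13 * (2 ^ 12 * (A₃ * N ^ 3)) := by rw [hW₀, isoModel_Δ]; ring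
  have hΔ : (3 : ℤ) ^ 13 ∣ W₀.Δ := by rw [eΔ]; exact dvd_mul_right _ _
  have hΔ' : ¬ (3 : ℤ) ^ (13 + 1) ∣ W₀.Δ := by
    rw [eΔ]; exact not_pow_succ_dvd_pow_mul' _ (not_three_dvd_mul not_three_dvd_two_pow
      (not_three_dvd_mul hA (not_three_dvd_pow hNu 3)))
  have h6' : ¬ (3 : ℤ) ^ (5 + 1) ∣ W₀.a₆ := by
    rw [e6]; refine not_pow_succ_dvd_pow_mul' 5 ?_
    rw [dvd_neg]; exact not_three_dvd_mul (by decide) (not_three_dvd_pow hNu 2)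
  -- Tate's algorithm on the cast model, in any presentation
  have hT : ∀ (v' : HeightOneSpectrum (𝓞 ℚ)) (ε : v'.adicCompletionIntegers ℚ), IsUnit ε →
      ((3 : ℕ) : v'.adicCompletionIntegers ℚ) = uniformizer (v'.adicCompletionIntegers ℚ) * ε →
      (W₀.map (Int.castRingHom (v'.adicCompletionIntegers ℚ))).kodairaSymbolOfMinimal = .IIstar := by
    intro v' ε hε hpε
    haveI := perfectField_residueField_adicCompletionIntegers (K := ℚ) v'
    refine kodairaSymbolOfMinimal_intCast_eq_IIstar Nat.prime_three hε hpε ?_ ?_ ?_ ?_ ?_ ?_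
    · rw [e1]; exact dvd_zero _
    · rw [e2]; exact natCast_pow_dvd_mul 2 _
    · rw [e3]; exact dvd_zero _
    · rw [e4]; exact natCast_pow_dvd_mul 4 _
    · rw [e6]; exact natCast_pow_dvd_mul 5 _
    · exact not_natCast_pow_dvd h6'
  exact kodairaSymbolAt_and_ordMinimalDiscriminant_placeOf_three_of_intModel W₀ W₀ 1 rfl (one_smul _ _).symm
    (fun v' hv' ↦ isMinimalAt_of_cast_kodairaSymbolOfMinimal_ne v' hv' W₀
      (fun ε hε hpε ↦ by rw [hT v' ε hε (by exact_mod_cast hpε)]; decide)) hΔ hΔ' hT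

/-- **`3 ∣ b`, `a = 2`: type `II` at `3`, `ord₃ Δ_min = 5`** — with `b = 3c`, `M = 9N`, `N = 3c³ − A₃`,
the given model has `v₃Δ = 17` and is NOT minimal; the rescaling `(u, r, s, t) = (3, 0, 0, 0)` gives the
integer model `[0, −27c², 0, 72cN, −48N²]` with `v₃Δ = 5`, Step-2 normalised, `3 ∥ a₆` ⟹ `II`.
[cite: SilvermanATAEC1994, IV.9.4 Steps 1–3] [cite: SilvermanAEC2009, VII.1 Remark 1.1] -/
theorem kodairaSymbolAt_and_ord_isoQ_two_of_dvd (b A₃ : ℤ) (hA : ¬ (3 : ℤ) ∣ A₃) (hb : (3 : ℤ) ∣ b) :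
    (isoQ b A₃ 2).kodairaSymbolAt (Additive.placeOf 3) = .II ∧
      (isoQ b A₃ 2).ordMinimalDiscriminant (Additive.placeOf 3) = 5 := by
  obtain ⟨c, rfl⟩ := hb
  set N := 3 * c ^ 3 - A₃ with hN
  have hNu : ¬ (3 : ℤ) ∣ N := by
    intro h
    have : (3 : ℤ) ∣ A₃ := by
      have h9 : (3 : ℤ) ∣ 3 * c ^ 3 := Dvd.intro (c ^ 3) rfl
      simpa [hN] using dvd_sub h9 h
    exact hA this
  have hN0 : N ≠ 0 := by rintro h0; rw [h0] at hNu; exact hNu (dvd_zero _)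
  have hA0 : A₃ ≠ 0 := by rintro h0; rw [h0] at hA; exact hA (dvd_zero _)
  -- the rescaled integer model and its relation to `isoQ`
  set R₀ : WeierstrassCurve ℤ := ⟨0, -(27 * c ^ 2), 0, 72 * (c * N), -(48 * N ^ 2)⟩ with hR₀
  have hMq : ((3 * c : ℤ) : ℚ) ^ 3 - (3 : ℚ) ^ 2 * (A₃ : ℚ) = 9 * (N : ℚ) := by
    rw [hN]; push_cast; ring
  haveI hell : (isoQ (3 * c) A₃ 2).IsElliptic := by
    refine ⟨(show (isoQ (3 * c) A₃ 2).Δ ≠ 0 from ?_).isUnit⟩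
    rw [isoQ, isoModel_Δ, hMq]
    have h1 : ((3 * c : ℤ) : ℚ) ^ 3 - 9 * (N : ℚ) = 9 * (A₃ : ℚ) := by rw [hN]; push_cast; ring
    rw [h1]
    have : (N : ℚ) ≠ 0 := by exact_mod_cast hN0
    have : (A₃ : ℚ) ≠ 0 := by exact_mod_cast hA0
    positivity
  have hrel : (⟨Units.mk0 (3 : ℚ) (by norm_num), 0, 0, 0⟩ : VariableChange ℚ) • isoQ (3 * c) A₃ 2 =
      R₀.baseChange ℚ := by
    ext <;> simp [variableChange_a₁, variableChange_a₂, variableChange_a₃, variableChange_a₄,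
      variableChange_a₆, isoQ, isoModel, hR₀, WeierstrassCurve.baseChange, WeierstrassCurve.map, hN] <;>
      ring
  -- the rescaled model: `v₃Δ = 5`, type `II`
  have e3 : R₀.a₃ = 0 := rfl
  have e4 : R₀.a₄ = 3 * (24 * (c * N)) := by simp [hR₀]; ring
  have e6 : R₀.a₆ = 3 ^ 1 * (-(16 * N ^ 2)) := by simp [hR₀]; ring
  have eb₂ : R₀.b₂ = 3 * (-(36 * c ^ 2)) := by simp [hR₀, WeierstrassCurve.b₂]; ring
  have eΔ : R₀.Δ = 3 ^ 5 * (2 ^ 12 * (A₃ * N ^ 3)) := by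
    simp only [hR₀, WeierstrassCurve.Δ, WeierstrassCurve.b₂, WeierstrassCurve.b₄, WeierstrassCurve.b₆,
      WeierstrassCurve.b₈, hN]
    ring
  have hΔ : (3 : ℤ) ^ 5 ∣ R₀.Δ := by rw [eΔ]; exact dvd_mul_right _ _
  have hΔ' : ¬ (3 : ℤ) ^ (5 + 1) ∣ R₀.Δ := by
    rw [eΔ]; exact not_pow_succ_dvd_pow_mul' _ (not_three_dvd_mul not_three_dvd_two_pow
      (not_three_dvd_mul hA (not_three_dvd_pow hNu 3)))
  have h6' : ¬ (3 : ℤ) ^ (1 + 1) ∣ R₀.a₆ := by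
    rw [e6]; refine not_pow_succ_dvd_pow_mul' 1 ?_
    rw [dvd_neg]; exact not_three_dvd_mul (by decide) (not_three_dvd_pow hNu 2)
  have hR : (R₀.baseChange ℚ).kodairaSymbolAt (Additive.placeOf 3) = .II ∧
      (R₀.baseChange ℚ).ordMinimalDiscriminant (Additive.placeOf 3) = 5 := by
    refine kodairaSymbolAt_and_ordMinimalDiscriminant_placeOf_three_of_intModel R₀ R₀ 1 rfl
      (one_smul _ _).symm
      (fun v' hv' ↦ isMinimalAt_of_criterion v' hv' R₀ hΔ hΔ' (Or.inl (by norm_num))) hΔ hΔ' ?_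
    intro v' ε hε hpε
    haveI := perfectField_residueField_adicCompletionIntegers (K := ℚ) v'
    obtain ⟨f1, f2, f3, f4, f6, fΔ⟩ := map_intCast_eqs (R := v'.adicCompletionIntegers ℚ) R₀
    refine kodairaSymbolOfMinimal_eq_II_of_step2 ?_ ?_ ?_ ?_ ?_ ?_
    · rw [fΔ]; exact uniformizer_dvd_intCast hpε ((pow_dvd_pow (3 : ℤ) (by norm_num : 1 ≤ 5)).trans hΔ)
    · rw [f3, e3]; simp
    · rw [f4, e4]; exact uniformizer_dvd_intCast hpε (by rw [pow_one]; exact dvd_mul_right _ _)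
    · rw [f6, e6]; exact uniformizer_dvd_intCast hpε (dvd_mul_right _ _)
    · rw [WeierstrassCurve.map_b₂, eb₂, eq_intCast]
      exact uniformizer_dvd_intCast hpε (by rw [pow_one]; exact dvd_mul_right _ _)
    · rw [f6]
      exact not_pow_succ_dvd_intCast Nat.prime_three hε hpε (n := 1)
        (by rw [e6]; exact natCast_pow_dvd_mul 1 _) (not_natCast_pow_dvd h6')
  exact kodairaSymbolAt_and_ordMinimalDiscriminant_of_smul_eq_baseChange _ _ R₀ hrel hR

/-! ## §3 The node T31 Case S, as typed -/

/-- **T31 Case S `FlexNFIsogenousCaseSKodairaLawThree` holds** (o5-r1 GEN 14; cc-typer-5 A-O5-29): for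
`a ∈ {1, 2}` and `3 ∤ A₃`, the isogenous model `isoQ b A₃ a` has at `3` the Kodaira symbol and conductor
exponent computed by `isoS a b` — `a = 1`: `II*`, `f₃ = 5` if `3 ∣ b`, else `IV*`, `f₃ = 4`; `a = 2`:
`II`, `f₃ = 5` if `3 ∣ b`, else `II*`, `f₃ = 3`.  Tate's algorithm at `3` (§2) + Ogg's formula (the tree's
definition of `conductorExponent` = `oggF`).  The node keeps its `@[conjecture]` tag in the typer's file
(the lane's restamp to make); census P-K20 (20 396 Case-S rows, 0 exceptions) stays EVIDENCE.
[cite: SilvermanATAEC1994, IV.9.4 and IV.11.1] -/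
theorem flexNFIsogenousCaseSKodairaLawThree_holds : FlexNFIsogenousCaseSKodairaLawThree := by
  intro a b A₃ ha hA
  have hb3 : (b % 3 = 0) ↔ (3 : ℤ) ∣ b := (Int.dvd_iff_emod_eq_zero ..).symm
  rcases ha with rfl | rfl
  · by_cases hb : (3 : ℤ) ∣ b
    · obtain ⟨hK, hord⟩ := kodairaSymbolAt_and_ord_isoQ_one_of_dvd b A₃ hA hb
      refine ⟨?_, ?_⟩
      · rw [hK]; simp [isoS, hb3.mpr hb]
      · unfold WeierstrassCurve.conductorExponent WeierstrassCurve.numComponentsAt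
        rw [hK, hord]; simp [isoS, oggF, hb3.mpr hb, KodairaSymbol.numComponents]
    · have hb' : ¬ b % 3 = 0 := fun h ↦ hb (hb3.mp h)
      obtain ⟨hK, hord⟩ := kodairaSymbolAt_and_ord_isoQ_one_of_not_dvd b A₃ hA hb
      refine ⟨?_, ?_⟩
      · rw [hK]; simp [isoS, hb']
      · unfold WeierstrassCurve.conductorExponent WeierstrassCurve.numComponentsAt
        rw [hK, hord]; simp [isoS, oggF, hb', KodairaSymbol.numComponents]
  · by_cases hb : (3 : ℤ) ∣ b
    · obtain ⟨hK, hord⟩ := kodairaSymbolAt_and_ord_isoQ_two_of_dvd b A₃ hA hb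
      refine ⟨?_, ?_⟩
      · rw [hK]; simp [isoS, hb3.mpr hb]
      · unfold WeierstrassCurve.conductorExponent WeierstrassCurve.numComponentsAt
        rw [hK, hord]; simp [isoS, oggF, hb3.mpr hb, KodairaSymbol.numComponents]
    · have hb' : ¬ b % 3 = 0 := fun h ↦ hb (hb3.mp h)
      obtain ⟨hK, hord⟩ := kodairaSymbolAt_and_ord_isoQ_two_of_not_dvd b A₃ hA hb
      refine ⟨?_, ?_⟩
      · rw [hK]; simp [isoS, hb']
      · unfold WeierstrassCurve.conductorExponent WeierstrassCurve.numComponentsAt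
        rw [hK, hord]; simp [isoS, oggF, hb', KodairaSymbol.numComponents]

end Summit.BirchSwinnertonDyer.Rank1Residual.O5.FlexNormalForm.Isogenous
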